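import Summits.BirchSwinnertonDyer.Rank1Residual.Partition.Bsdp
import HarnessLib

/-!
# The STRONG PARTIAL THEOREM of the cell (coordinator ruling 2026-08-20T22:24Z, (A1)): `BSD(E,p)` for
# every `E/ℚ` of analytic rank `≤ 1` at every ODD prime of GOOD reduction — and at every odd
# MULTIPLICATIVE prime when `r = 0` — outside EXPLICIT named corners, assembled in the kernel from the
# published theorems already bound in `Partition/Bsdp.lean`

HONEST FRAMING (cell `b2b-bsdres`, `run/shared/lean/b2b/bsd-rank1-residual/`, verbatim): the goal is
to DELETE the COMBINATION-SHAPED residual classes for ALL analytic-rank `≤ 1` curves over `ℚ` — "full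
BSD formula for every rank `≤ 1` curve in class C" assembled STRICTLY from published theorems — so that
the rank-`≤ 1` remainder becomes exactly the CONSTRUCTION-SHAPED classes, which are TYPED (missing-input
Props), NOT attempted; this is not "finishing BSD". Research route; no claim beyond stated classes.
Nothing here is booked; no label moves; no new fact is introduced (every published input is one of
the fourteen NAMED facts already consumed by `bsdp_of_covered`, p199353, each carrying its own
PUB / PUB\* / [sec] flag in `HOME/CITED-FACTS.md`).

## What this file proves (all from `Partition.partition` + `Partition/Bsdp.bsdp_or_residual`)

* `bsdp_of_not_residual` — granted the fourteen named facts: `ord_{s=1} L(E,s) ≤ 1` and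
  `¬ Residual W p` imply Miller's `BSD(E,p)` (`BSDp W p`). (`Residual` = the disjunction of the
  cell's typed class predicates `ClassX1 … ClassX12`, `ClassX9im`, `ClassX11a`, `ClassX11b`,
  `Partition/Rows.lean`.)
* `residual_iff_goodOddCorner_or_classX12` — at an ODD prime of GOOD reduction the residual
  disjunction collapses, by reduction-type bookkeeping alone, to the SEVEN non-CM corners
  `GoodOddCorner W p := X1 ∨ X6 ∨ X7 ∨ X8 ∨ X9 ∨ X9im ∨ X10` or the CM class X12 (X2/X11/X11a/X11b
  need multiplicative reduction, X3/X4 additive, X5 `p = 2`). Each corner is an EXPLICIT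
  predicate in the typed vocabulary (`Red/Irr/Surj/BigIm`, `Anom`, `GVPar`, `GoodOrd/GoodSS`,
  `Semistable`, `Ram`, `a_3`, the rank): see `Rank1Residual/Predicates.lean` and
  `Partition/Rows.lean`, quoted in the docstring of `GoodOddCorner`.
* `bsdp_of_hasCM_of_good_odd` — a CM curve of analytic rank `≤ 1` satisfies `BSD(E,p)` at EVERY
  odd prime of good reduction (rows C8 / C10: Rubin–Burungale–Flach, Kobayashi 2013 Cor. 1.4
  [sec]) — so no CM pair is a corner at such primes (in particular the literal overlap of
  `ClassX7 = GoodSS ∧ ¬ Semistable` and of `ClassX12` with CM pairs costs nothing).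
* `bsdp_of_good_odd_of_not_corner` — **the headline**: for `E/ℚ` (globally minimal `W`) with
  `ord_{s=1} L(E,s) ≤ 1` and an odd prime `p` of good reduction such that `(E, p)` is NOT in the
  seven corners (vacuous for CM curves), `BSD(E,p)`.
* `residual_iff_red_or_not_ram_of_mult_rankZero` and `bsdp_of_mult_odd_rankZero` — at an odd
  MULTIPLICATIVE prime with `r = 0` the residual disjunction collapses to `Red W p ∨ ¬ Ram W p`
  (classes X2, X11/X11a); hence `BSD(E,p)` for `r = 0`, `p ∥ N` odd, `E[p]` irreducible with a
  (ram) witness — the multiplicative clause of the ruling (it is Skinner 2016 Thm. C's locus; the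
  point of the statement is that NOTHING ELSE is needed there).

The corners are exactly the cell's residual classes met at such primes; their labels
(COMBINATION-SHAPED or CONSTRUCTION-SHAPED, announced-OPEN inputs) live in `HOME/CLASSES.md` and are not
restated here. `#print axioms` standard expected (case analysis only).

References: `Partition.lean` (p197901: `partition`), `Partition/Bsdp.lean` (p199353:
`bsdp_or_residual`, the fourteen facts and their rows C1/C2/C3/C6/C7/C8/C10/C16/C17),
`Partition/Rows.lean` (`Residual`, `ClassX9im`, `ClassX11a`, `ClassX11b`),
`Literature/NumberTheory/EllipticCurves/Rank1Residual/Predicates.lean` (`ClassX1`–`ClassX12` verbatim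
from RESIDUAL-CASES §a.2 v3 = CLASSES.md); coordinator ruling relayed by bsd-director gen 7
(HOME/INBOX 2026-08-20T22:31Z); Miller 2011 Def. 1.1 (`BSDp`).
-/

noncomputable section

namespace Summit.BirchSwinnertonDyer.Rank1Residual

open WeierstrassCurve Literature.NumberTheory.EllipticCurves
  Literature.NumberTheory.EllipticCurves.Rank1Residual Literature.NumberTheory.EllipticCurves.ModularForms
open scoped NumberField

section Curve

open scoped Classical

variable {W : WeierstrassCurve ℚ} [W.IsElliptic] [W.IsGloballyMinimal] {p : ℕ} [Fact p.Prime]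

/-- **Granted the fourteen named published facts of the covered rows, a pair `(E, p)` of analytic
rank `≤ 1` outside EVERY residual class satisfies `BSD(E,p)`.** One line from `bsdp_or_residual`.
[folklore] -/
theorem bsdp_of_not_residual (hSk : Skinner2016.thmC_padicValRat_bsd_rank_zero)
    (hBCS : BurungaleCastellaSkinner2025.cor131_padicValRat_bsd_rank_le_one)
    (hJSW : JetchevSkinnerWan2017.thm121_padicValRat_bsd_rank_one)
    (hCGS : CastellaGrossiSkinner2025.thmD_padicValRat_bsd_rank_le_one)
    (hGV : GreenbergVatsal2000.thm13_charIdeal_eq_of_gvPar) (hGr : greenberg_charValue_rankZero)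
    (hmod : hasEntireLFunction_rat) (hmodP : nonempty_modularParametrizationData)
    (hGZK : rank_eq_analyticRank_of_analyticRank_le_one)
    (hCM : bsdTriple_of_hasCM_of_L_one_ne_zero) (hKob : Kobayashi2013.cor14_bsdp_of_cm_rank_one)
    (hYZ : YanZhu2026.thm415_padicValRat_bsd_rank_le_one)
    (hW20 : Wuthrich2014.lemma20_surjective_threeAdic_of_semistable)
    (hLLT : LiLiuTian2024.thm11_bsdp_of_cm_rank_one)
    (hr : W.analyticRank ≤ 1) (hn : ¬ Residual W p) : BSDp W p :=
  (bsdp_or_residual hSk hBCS hJSW hCGS hGV hGr hmod hmodP hGZK hCM hKob hYZ hW20 hLLT hr).resolve_right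
    hn

variable (W p) in
/-- **The corners at an odd prime of good reduction** — the residual classes that can hold at a pair
`(E, p)` with `p` odd and `E` of good reduction at `p` (each an explicit predicate in the cell's
typed vocabulary, `Rank1Residual/Predicates.lean` / `Partition/Rows.lean`, quoted):
* X1  `2 < p ∧ Red W p ∧ Good W p ∧ Anom W p ∧ ¬(r = 0 ∧ GVPar W p)` — anomalous Eisenstein;
* X6  `GoodSS W p ∧ Semistable W ∧ (5 ≤ p ∨ a_3 = 0)` — supersingular, semistable;
* X7  `GoodSS W p ∧ ¬ Semistable W` — supersingular, non-semistable;
* X8  `p = 3 ∧ GoodSS W 3 ∧ a_3 ≠ 0`;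
* X9  `¬ cm ∧ GoodOrd W p ∧ 5 ≤ p ∧ Irr W p ∧ ¬ Surj W p ∧ (r = 1 → ¬ Semistable W)` and its
  printed form X9im (`¬ BigIm` for `¬ Surj`) — small irreducible image;
* X10 `p = 3 ∧ GoodOrd W 3 ∧ Irr W 3 ∧ ((r = 0 ∧ ¬ Ram W 3) ∨ (r = 1 ∧ ¬ Semistable W))`.
(The CM class X12 is NOT a corner here: every CM pair of analytic rank `≤ 1` at an odd good prime
is covered, `bsdp_of_hasCM_of_good_odd`; for the same reason the corners only matter for non-CM
curves, although X6/X7/X8 as typed do not themselves say `¬ cm`.) [folklore] -/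
def GoodOddCorner : Prop :=
  ClassX1 W p ∨ ClassX6 W p ∨ ClassX7 W p ∨ ClassX8 W p ∨ ClassX9 W p ∨ ClassX9im W p ∨
    ClassX10 W p

/-- **At an odd good prime the residual disjunction IS "one of the seven corners, or the CM class
X12"** (pure reduction-type bookkeeping: X2, X11, X11a, X11b require multiplicative reduction, X3,
X4 additive reduction, X5 `p = 2`). [folklore] -/
theorem residual_iff_goodOddCorner_or_classX12 (hp : p ≠ 2) (hg : Good W p) :
    Residual W p ↔ (GoodOddCorner W p ∨ ClassX12 W p) := by
  have hnm : ¬ Mult W p := not_mult_of_good W p hg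
  constructor
  · intro h
    rcases h with h | h | h | h | h | h | h | h | h | h | h | h | h | h | h
    · exact Or.inl <| Or.inl h
    · exact absurd h.2.2 hnm
    · exact absurd hg h.2.1
    · exact absurd hg h.2.1.1
    · exact absurd h hp
    · exact Or.inl <| Or.inr <| Or.inl h
    · exact Or.inl <| Or.inr <| Or.inr <| Or.inl h
    · exact Or.inl <| Or.inr <| Or.inr <| Or.inr <| Or.inl h
    · exact Or.inl <| Or.inr <| Or.inr <| Or.inr <| Or.inr <| Or.inl h
    · exact Or.inl <| Or.inr <| Or.inr <| Or.inr <| Or.inr <| Or.inr <| Or.inr h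
    · exact absurd h.1 hnm
    · exact Or.inr h
    · exact Or.inl <| Or.inr <| Or.inr <| Or.inr <| Or.inr <| Or.inr <| Or.inl h
    · exact absurd h.2.2.1 hnm
    · exact absurd h.2.2.1 hnm
  · intro h
    rcases h with (h | h | h | h | h | h | h) | h
    · exact Or.inl h
    · exact Or.inr <| Or.inr <| Or.inr <| Or.inr <| Or.inr <| Or.inl h
    · exact Or.inr <| Or.inr <| Or.inr <| Or.inr <| Or.inr <| Or.inr <| Or.inl h
    · exact Or.inr <| Or.inr <| Or.inr <| Or.inr <| Or.inr <| Or.inr <| Or.inr <| Or.inl h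
    · exact Or.inr <| Or.inr <| Or.inr <| Or.inr <| Or.inr <| Or.inr <| Or.inr <| Or.inr <| Or.inl h
    · exact Or.inr <| Or.inr <| Or.inr <| Or.inr <| Or.inr <| Or.inr <| Or.inr <| Or.inr <| Or.inr <|
        Or.inr <| Or.inr <| Or.inr <| Or.inl h
    · exact Or.inr <| Or.inr <| Or.inr <| Or.inr <| Or.inr <| Or.inr <| Or.inr <| Or.inr <| Or.inr <|
        Or.inl h
    · exact Or.inr <| Or.inr <| Or.inr <| Or.inr <| Or.inr <| Or.inr <| Or.inr <| Or.inr <| Or.inr <|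
        Or.inr <| Or.inr <| Or.inl h

/-- **CM curves are never a corner at an odd good prime**: for `W/ℚ` globally minimal with CM and
`ord_{s=1} L(E,s) ≤ 1`, `BSD(E,p)` holds at every odd prime `p` of good reduction — row C8
(`r = 0`: Rubin 1991 / Burungale–Flach 2024 Cor. 2 via the CM triple `hCM`, with modularity
`hmod`) or row C10 (`r = 1`: Kobayashi 2013 Cor. 1.4, `hKob`, PUB[sec] flag travelling with the
fact). [folklore] -/
theorem bsdp_of_hasCM_of_good_odd (hCM : bsdTriple_of_hasCM_of_L_one_ne_zero)
    (hmod : hasEntireLFunction_rat) (hKob : Kobayashi2013.cor14_bsdp_of_cm_rank_one)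
    (hr : W.analyticRank ≤ 1) (hp : p ≠ 2) (hg : Good W p) (hcm : W.HasCM) : BSDp W p := by
  rcases Nat.lt_or_ge W.analyticRank 1 with h0 | h1
  · exact RowC8.bsdp hCM hmod ⟨hcm, by omega⟩
  · exact RowC10.bsdp hKob ⟨hcm, by omega, hp, hg⟩

/-- **THE STRONG PARTIAL THEOREM (good primes).** Granted the fourteen named published facts of the
covered rows (Skinner 2016 Thm. C; Burungale–Castella–Skinner 2025 Cor. 1.3.1 (PUB\*); Jetchev–
Skinner–Wan 2017 Thm. 1.2.1; Castella–Grossi–Skinner 2025 Thm. D; Greenberg–Vatsal 2000 Thm. 1.3;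
Greenberg 1999 Thm. 4.1; modularity ×2; Gross–Zagier–Kolyvagin; Rubin 1991 / the CM triple;
Kobayashi 2013 Cor. 1.4 ([sec]); Yan–Zhu 2026 Thm. 4.15 (PUB\*); Wuthrich 2014 Lemma 20;
Li–Liu–Tian 2024 Thm. 1.1): for every globally minimal elliptic `W/ℚ` with `ord_{s=1} L(E,s) ≤ 1`
and every ODD prime `p` of GOOD reduction, if `(E, p)` lies in none of the seven corners
`GoodOddCorner W p` (anomalous Eisenstein X1; supersingular X6/X7/X8; small irreducible image
X9/X9im; the `p = 3` floor X10), then Miller's `BSD(E,p)` holds. CM curves need no corner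
hypothesis (`bsdp_of_hasCM_of_good_odd`); the case split on `W.HasCM` is internal. [folklore] -/
theorem bsdp_of_good_odd_of_not_corner (hSk : Skinner2016.thmC_padicValRat_bsd_rank_zero)
    (hBCS : BurungaleCastellaSkinner2025.cor131_padicValRat_bsd_rank_le_one)
    (hJSW : JetchevSkinnerWan2017.thm121_padicValRat_bsd_rank_one)
    (hCGS : CastellaGrossiSkinner2025.thmD_padicValRat_bsd_rank_le_one)
    (hGV : GreenbergVatsal2000.thm13_charIdeal_eq_of_gvPar) (hGr : greenberg_charValue_rankZero)
    (hmod : hasEntireLFunction_rat) (hmodP : nonempty_modularParametrizationData)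
    (hGZK : rank_eq_analyticRank_of_analyticRank_le_one)
    (hCM : bsdTriple_of_hasCM_of_L_one_ne_zero) (hKob : Kobayashi2013.cor14_bsdp_of_cm_rank_one)
    (hYZ : YanZhu2026.thm415_padicValRat_bsd_rank_le_one)
    (hW20 : Wuthrich2014.lemma20_surjective_threeAdic_of_semistable)
    (hLLT : LiLiuTian2024.thm11_bsdp_of_cm_rank_one)
    (hr : W.analyticRank ≤ 1) (hp : p ≠ 2) (hg : Good W p) (hc : ¬ GoodOddCorner W p) :
    BSDp W p := by
  by_cases hcm : W.HasCM
  · exact bsdp_of_hasCM_of_good_odd hCM hmod hKob hr hp hg hcm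
  · refine bsdp_of_not_residual hSk hBCS hJSW hCGS hGV hGr hmod hmodP hGZK hCM hKob hYZ hW20 hLLT hr
      fun h => ?_
    rcases (residual_iff_goodOddCorner_or_classX12 hp hg).1 h with h' | h'
    · exact hc h'
    · exact hcm h'.1

/-- **At an odd multiplicative prime with `r = 0` the residual disjunction collapses to
`Red W p ∨ ¬ Ram W p`** (X2 = reducible; X11/X11a = no (ram) witness; X11b needs `r = 1`; every
other class needs good or additive reduction, `p = 2`, or `r = 1`). [folklore] -/
theorem residual_iff_red_or_not_ram_of_mult_rankZero (hp : p ≠ 2) (hm : Mult W p)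
    (hr0 : W.analyticRank = 0) : Residual W p ↔ (Red W p ∨ ¬ Ram W p) := by
  have hng : ¬ Good W p := fun hg => not_mult_of_good W p hg hm
  have hr1 : W.analyticRank ≠ 1 := by omega
  constructor
  · intro h
    rcases h with h | h | h | h | h | h | h | h | h | h | h | h | h | h | h
    · exact absurd h.2.2.1 hng
    · exact Or.inl h.2.1
    · exact absurd hm h.2.2
    · exact absurd hm h.2.1.2
    · exact absurd h hp
    · exact absurd h.1.1 hng
    · exact absurd h.1.1 hng
    · obtain ⟨rfl, h3, -⟩ := h
      exact absurd h3.1 hng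
    · exact absurd h.2.1.1 hng
    · obtain ⟨rfl, h3, -⟩ := h
      exact absurd h3.1 hng
    · rcases h.2.2 with h' | h' | h'
      · exact Or.inr h'
      · exact absurd h'.1 hr1
      · exact absurd h'.1 hr1
    · exact absurd h.2.1 hr1
    · exact absurd h.2.1.1 hng
    · exact Or.inr h.2.2.2.2
    · exact absurd h.1 hr1
  · intro h
    rcases h with h | h
    · exact Or.inr <| Or.inl ⟨hp, h, hm⟩
    · by_cases hi : Irr W p
      · -- X11a
        exact Or.inr <| Or.inr <| Or.inr <| Or.inr <| Or.inr <| Or.inr <| Or.inr <| Or.inr <| Or.inr <|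
          Or.inr <| Or.inr <| Or.inr <| Or.inr <| Or.inl ⟨hr0, hp, hm, hi, h⟩
      · exact Or.inr <| Or.inl ⟨hp, hi, hm⟩

/-- **THE STRONG PARTIAL THEOREM (multiplicative primes, rank `0`).** Granted the same fourteen named
facts: for every globally minimal elliptic `W/ℚ` with `ord_{s=1} L(E,s) = 0` and every ODD prime `p`
of MULTIPLICATIVE reduction with `E[p]` irreducible and a (ram) witness (`Ram W p`: a
multiplicative `q ≠ p` with `p ∤ v_q(Δ_min)`), `BSD(E,p)` holds — outside exactly the corners X2
(`E[p]` reducible) and X11a (no (ram) witness). [folklore] -/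
theorem bsdp_of_mult_odd_rankZero (hSk : Skinner2016.thmC_padicValRat_bsd_rank_zero)
    (hBCS : BurungaleCastellaSkinner2025.cor131_padicValRat_bsd_rank_le_one)
    (hJSW : JetchevSkinnerWan2017.thm121_padicValRat_bsd_rank_one)
    (hCGS : CastellaGrossiSkinner2025.thmD_padicValRat_bsd_rank_le_one)
    (hGV : GreenbergVatsal2000.thm13_charIdeal_eq_of_gvPar) (hGr : greenberg_charValue_rankZero)
    (hmod : hasEntireLFunction_rat) (hmodP : nonempty_modularParametrizationData)
    (hGZK : rank_eq_analyticRank_of_analyticRank_le_one)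
    (hCM : bsdTriple_of_hasCM_of_L_one_ne_zero) (hKob : Kobayashi2013.cor14_bsdp_of_cm_rank_one)
    (hYZ : YanZhu2026.thm415_padicValRat_bsd_rank_le_one)
    (hW20 : Wuthrich2014.lemma20_surjective_threeAdic_of_semistable)
    (hLLT : LiLiuTian2024.thm11_bsdp_of_cm_rank_one)
    (hr0 : W.analyticRank = 0) (hp : p ≠ 2) (hm : Mult W p) (hirr : Irr W p) (hram : Ram W p) :
    BSDp W p :=
  bsdp_of_not_residual hSk hBCS hJSW hCGS hGV hGr hmod hmodP hGZK hCM hKob hYZ hW20 hLLT (by omega)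
    fun h => by
      rcases (residual_iff_red_or_not_ram_of_mult_rankZero hp hm hr0).1 h with h' | h'
      · exact h' hirr
      · exact h' hram

end Curve

end Summit.BirchSwinnertonDyer.Rank1Residual

end
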